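import Literature.Analysis.Calculus.AnalyticRootFunctionsReal
import Literature.Analysis.Calculus.MonomialUnits
import Literature.Algebra.Polynomial.MidpointResultant
import Literature.Algebra.Polynomial.ConjugatePairProducts
import Mathlib.Analysis.Analytic.Polynomial
import Mathlib.FieldTheory.IsAlgClosed.Basic
import Mathlib.Analysis.Complex.Polynomial.Basic
import HarnessLib

/-!
# Jung's projection method: real structure of the analytic roots over a prepared base chart

Let `Rh ∈ ℚ[x][T]` be monic, `M` its midpoint resultant (`Literature.Algebra.Polynomial`), and
`P ∈ ℚ[x][T]` monic with `κ M ∣ P^m` (e.g. the monic square-free part of `2^{-D²} M`), so that over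
every point the roots of `Rh` and all their pairwise midpoints are roots of `P`. Suppose that along a
map `χ` analytic on a box `B = (−δ, 1+δ)ᵈ` the polynomial `P(χ(σ), T)` splits into linear factors
`T − ζ_l(σ)` with `ζ_l` analytic on `B` and pairwise distinct over the open unit cube `Ω` (the output
of `JungBaseChart.exists_base_chart`). Then (`exists_root_structure`):

* conjugation permutes the `ζ_l` through an involution `τ` (on all of `B`);
* the real root functions are enumerated increasingly over `Ω` by walls `ζ_{r m}`, and the real
  roots of `P(χ(σ), ·)` over `σ ∈ Ω` are exactly the wall values;
* `Rh(χ(σ), T) = ∏_l (T − ζ_l(σ))^{e_l}` on `B` with constant, `τ`-invariant exponents;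
* the real part of every `ζ_l` occurring in `Rh` (`e_l > 0`) is itself a wall (midpoint closure).

All of this is bookkeeping over `Literature/Analysis/Calculus/AnalyticRootFunctions*.lean`
(namespace `Literature.NumberTheory.Transcendental.JungPreparation`).

## References

* H. W. E. Jung, J. reine angew. Math. 133 (1908); J. Kollár, *Lectures on Resolution of
  Singularities* (2007), §2.3.
-/

noncomputable section

open Set Polynomial
open scoped ComplexConjugate
open Literature.Analysis.Calculus
open Literature.Algebra.Polynomial

namespace Literature.NumberTheory.Transcendental.JungPreparation

variable {d : ℕ}

/-- A real polynomial, base-changed to `ℂ`, commutes with conjugation under evaluation. [folklore] -/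
theorem eval_conj_map_ofReal (q : ℝ[X]) (z : ℂ) :
    (q.map (algebraMap ℝ ℂ)).eval (conj z) = conj ((q.map (algebraMap ℝ ℂ)).eval z) := by
  rw [eval_map, eval_map, hom_eval₂]
  congr 1
  ext x
  simp

/-- A real polynomial, base-changed to `ℂ`, is fixed by coefficientwise conjugation. [folklore] -/
theorem map_conj_map_ofReal (q : ℝ[X]) :
    (q.map (algebraMap ℝ ℂ)).map (starRingEnd ℂ) = q.map (algebraMap ℝ ℂ) := by
  rw [Polynomial.map_map]
  congr 1
  ext x
  simp

/-- The centre of the unit cube lies in the open unit cube. [folklore] -/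
theorem center_mem_pi_Ioo : (fun _ : Fin d => (2⁻¹ : ℝ)) ∈ Set.pi Set.univ (fun _ : Fin d => Ioo (0 : ℝ) 1) :=
  fun _ _ => ⟨by norm_num, by norm_num⟩

/-- **Real structure of the analytic roots over a prepared base chart.** See the module
docstring (Jung 1908; Kollár 2007, §2.3). [folklore] -/
theorem exists_root_structure {n : ℕ} {δ : ℝ} (hδ : 0 < δ)
    {P Rh M : (MvPolynomial (Fin d) ℚ)[X]} (hRh : Rh.Monic)
    (hM : M = (Rh.map C).resultant ((Rh.map C).comp (C (2 * X) - X)) Rh.natDegree Rh.natDegree)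
    {κ : ℚ} {m : ℕ} (hMP : C (MvPolynomial.C κ) * M ∣ P ^ m)
    (χ : (Fin d → ℝ) → (Fin d → ℝ))
    (hχa : AnalyticOnNhd ℝ χ (Set.pi Set.univ (fun _ : Fin d => Ioo (-δ) (1 + δ))))
    (ζ : Fin n → (Fin d → ℝ) → ℂ)
    (hζa : ∀ l, AnalyticOnNhd ℝ (ζ l) (Set.pi Set.univ (fun _ : Fin d => Ioo (-δ) (1 + δ))))
    (hfac : ∀ σ ∈ Set.pi Set.univ (fun _ : Fin d => Ioo (-δ) (1 + δ)),
      P.map ((algebraMap ℝ ℂ).comp (MvPolynomial.eval₂Hom (algebraMap ℚ ℝ) (χ σ))) =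
        ∏ l, (X - C (ζ l σ)))
    (hinj : ∀ σ ∈ Set.pi Set.univ (fun _ : Fin d => Ioo (0 : ℝ) 1), Function.Injective fun l => ζ l σ) :
    ∃ (τ : Fin n → Fin n) (p : ℕ) (r : Fin p → Fin n) (e : Fin n → ℕ),
      Function.Involutive τ ∧
      (∀ l, ∀ σ ∈ Set.pi Set.univ (fun _ : Fin d => Ioo (-δ) (1 + δ)), conj (ζ l σ) = ζ (τ l) σ) ∧
      Function.Injective r ∧ (∀ m, τ (r m) = r m) ∧ (∀ l, τ l = l → ∃ m, r m = l) ∧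
      (∀ σ ∈ Set.pi Set.univ (fun _ : Fin d => Ioo (0 : ℝ) 1), StrictMono fun m => (ζ (r m) σ).re) ∧
      (∀ σ ∈ Set.pi Set.univ (fun _ : Fin d => Ioo (0 : ℝ) 1), ∀ t : ℝ,
        (∃ l, (t : ℂ) = ζ l σ) ↔ ∃ m, t = (ζ (r m) σ).re) ∧
      (∀ σ ∈ Set.pi Set.univ (fun _ : Fin d => Ioo (-δ) (1 + δ)),
        Rh.map ((algebraMap ℝ ℂ).comp (MvPolynomial.eval₂Hom (algebraMap ℚ ℝ) (χ σ))) =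
          ∏ l, (X - C (ζ l σ)) ^ e l) ∧
      (∀ l, e (τ l) = e l) ∧
      (∀ l, 0 < e l → ∃ m, ∀ σ ∈ Set.pi Set.univ (fun _ : Fin d => Ioo (-δ) (1 + δ)),
        ((ζ l σ).re : ℂ) = ζ (r m) σ) := by
  classical
  set Bx := Set.pi Set.univ (fun _ : Fin d => Ioo (-δ) (1 + δ)) with hBx
  set Ω := Set.pi Set.univ (fun _ : Fin d => Ioo (0 : ℝ) 1) with hΩ
  have hΩB : Ω ⊆ Bx := pi_Ioo_subset_box hδ
  have hΩo : IsOpen Ω := isOpen_set_pi finite_univ fun _ _ => isOpen_Ioo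
  have hΩne : Ω.Nonempty := ⟨_, center_mem_pi_Ioo⟩
  have hΩc : IsPreconnected Ω := isPreconnected_box 0 1
  have hBc : IsPreconnected Bx := isPreconnected_box _ _
  have hBo : IsOpen Bx := isOpen_set_pi finite_univ fun _ _ => isOpen_Ioo
  set evC : (Fin d → ℝ) → (MvPolynomial (Fin d) ℚ →+* ℂ) := fun x =>
    (algebraMap ℝ ℂ).comp (MvPolynomial.eval₂Hom (algebraMap ℚ ℝ) x) with hevC
  have hmapC : ∀ (q : (MvPolynomial (Fin d) ℚ)[X]) (x : Fin d → ℝ),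
      q.map (evC x) = (q.map (MvPolynomial.eval₂Hom (algebraMap ℚ ℝ) x)).map (algebraMap ℝ ℂ) :=
    fun q x => (Polynomial.map_map _ _ q).symm
  -- ### real coefficients: conjugates of roots are roots
  have hconj : ∀ σ ∈ Ω, ∀ l, ∃ l', conj (ζ l σ) = ζ l' σ := by
    intro σ hσ l
    have hroot : ((P.map (evC (χ σ))).eval (conj (ζ l σ))) = 0 := by
      rw [hmapC, eval_conj_map_ofReal, ← hmapC, hfac σ (hΩB hσ), eval_prod]
      simp only [map_eq_zero]
      exact Finset.prod_eq_zero (Finset.mem_univ l) (by simp)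
    rw [hfac σ (hΩB hσ), eval_prod, Finset.prod_eq_zero_iff] at hroot
    obtain ⟨l', -, hl'⟩ := hroot
    exact ⟨l', by simpa [sub_eq_zero] using hl'⟩
  obtain ⟨τ, hτ, hτinv⟩ := exists_conj_perm hBc hΩB hΩo hΩne hζa hinj hconj
  obtain ⟨p, r, hrinj, hrfix, hrsurj, hmono, hiff⟩ :=
    exists_strictMono_walls hΩB hΩc hΩne hζa hinj hτ
  -- ### roots of `Rh` and of the midpoint resultant are roots of `P`
  have hRh0 : ∀ x, Rh.map (evC x) ≠ 0 := fun x => (hRh.map _).ne_zero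
  have hMroot : ∀ (x : Fin d → ℝ) (t : ℂ), (M.map (evC x)).eval t = 0 → (P.map (evC x)).eval t = 0 := by
    intro x t ht
    have hdvd : (C (MvPolynomial.C κ) * M).map (evC x) ∣ (P ^ m).map (evC x) :=
      Polynomial.map_dvd _ hMP
    have h0 : ((C (MvPolynomial.C κ) * M).map (evC x)).eval t = 0 := by
      rw [Polynomial.map_mul, eval_mul, ht, mul_zero]
    have h1 := eval_eq_zero_of_dvd_of_eval_eq_zero hdvd h0
    rw [Polynomial.map_pow, eval_pow] at h1
    by_contra h
    exact pow_ne_zero m h h1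
  have hmid : ∀ (x : Fin d → ℝ) (a b : ℂ), a ∈ (Rh.map (evC x)).roots → b ∈ (Rh.map (evC x)).roots →
      (P.map (evC x)).eval ((a + b) / 2) = 0 := by
    intro x a b ha hb
    apply hMroot
    rw [map_eval_midpointResultant hRh hM (evC x) (IsAlgClosed.splits _)]
    refine Multiset.prod_eq_zero (Multiset.mem_map.2 ⟨a, ha, ?_⟩)
    refine Multiset.prod_eq_zero (Multiset.mem_map.2 ⟨b, hb, ?_⟩)
    ring
  have hRhroot : ∀ (x : Fin d → ℝ) (t : ℂ), (Rh.map (evC x)).eval t = 0 → (P.map (evC x)).eval t = 0 := by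
    intro x t ht
    have hmem : t ∈ (Rh.map (evC x)).roots := (mem_roots (hRh0 x)).2 ht
    have h := hmid x t t hmem hmem
    rwa [show (t + t) / 2 = t by ring] at h
  have hProot : ∀ σ ∈ Bx, ∀ t : ℂ, (P.map (evC (χ σ))).eval t = 0 → ∃ l, t = ζ l σ := by
    intro σ hσ t ht
    rw [hfac σ hσ, eval_prod, Finset.prod_eq_zero_iff] at ht
    obtain ⟨l, -, hl⟩ := ht
    exact ⟨l, by simpa [sub_eq_zero] using hl⟩
  -- ### constant exponents of `Rh`
  have hcoeff : ∀ k, AnalyticOnNhd ℝ (fun σ => (Rh.map (evC (χ σ))).coeff k) Bx := by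
    intro k σ hσ
    simp only [coeff_map, hevC, RingHom.comp_apply]
    refine (Complex.ofRealCLM.analyticAt _).comp ?_
    exact AnalyticAt.aeval_mvPolynomial (fun i => (analyticAt_pi_iff.1 (hχa σ hσ)) i) _
  obtain ⟨e, he⟩ := exists_eq_prod_pow_of_roots_subset hBo hBc hΩB hΩo hΩne hζa Rh.natDegree
    (fun σ => Rh.map (evC (χ σ))) (fun σ _ => hRh.map _) (fun σ _ => hRh.natDegree_map _) hcoeff
    (fun σ hσ t ht => hProot σ (hΩB hσ) t (hRhroot _ t ht))
  -- ### `τ`-invariance of the exponents (real coefficients)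
  set σ₀ : Fin d → ℝ := fun _ => 2⁻¹ with hσ₀
  have hσ₀Ω : σ₀ ∈ Ω := center_mem_pi_Ioo
  have heτ : ∀ l, e (τ l) = e l := by
    refine exp_comp_perm_eq (hinj σ₀ hσ₀Ω) hτinv (fun l => (hτ l σ₀ (hΩB hσ₀Ω)).symm) ?_
    rw [← he σ₀ (hΩB hσ₀Ω), hmapC, map_conj_map_ofReal]
  -- ### real parts of roots of `Rh` are walls
  have hRhz : ∀ σ ∈ Bx, ∀ l, 0 < e l → ζ l σ ∈ (Rh.map (evC (χ σ))).roots := by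
    intro σ hσ l hl
    rw [mem_roots (hRh0 _), IsRoot.def, he σ hσ, eval_prod]
    exact Finset.prod_eq_zero (Finset.mem_univ l) (by simp [zero_pow hl.ne'])
  have hwall : ∀ l, 0 < e l → ∃ m, ∀ σ ∈ Bx, ((ζ l σ).re : ℂ) = ζ (r m) σ := by
    intro l hl
    refine exists_re_eq_wall hBc hΩB hΩo hΩne hζa hinj hτ hrsurj (S := {l | 0 < e l})
      (fun l' hl' => by simpa [heτ l'] using hl') (fun σ hσ l₁ hl₁ l₂ hl₂ => ?_) hl
    obtain ⟨l'', hl''⟩ := hProot σ (hΩB hσ) _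
      (hmid (χ σ) _ _ (hRhz σ (hΩB hσ) l₁ hl₁) (hRhz σ (hΩB hσ) l₂ hl₂))
    exact ⟨l'', by rw [← hl'']; ring⟩
  exact ⟨τ, p, r, e, hτinv, hτ, hrinj, hrfix, hrsurj, hmono, hiff, he, heτ, hwall⟩

end Literature.NumberTheory.Transcendental.JungPreparation
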